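import Literature.NumberTheory.Sieve.RosserSieveLemma13Ratios
import HarnessLib

/-!
# Iwaniec's Lemma 13, II: the asymptotic formula (6.5) for `a = Q⁺ + Q⁻` by barrier functions

Topic `Literature/NumberTheory/Sieve`; Iwaniec, *Rosser's sieve*, Acta Arith. 36 (1980), §6, Lemma 13
(6.5): `Q⁺(s) = exp{−s log s − s log log s + s log(eκ) + O(s log log 2s / log s)}`. Iwaniec proves
this through Lemmas 15–16; here it is obtained for `a = Q⁺ + Q⁻ = majA` (`Q⁺ ≍ a` by (6.3),
`RosserSieveLemma13Ratios.lean`) by two explicit barriers propagated along unit intervals with the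
pairing identity (6.12), `s G(s) a(s) = κ ∫_{s−1}^s G(x + 1) a(x) dx`:

* **upper barrier** `a(s) ≤ M e^{−φ(s)}`, `φ(s) = s log s + s log log s − s log(eκ)`: if it holds on
  `[s − 1, s)` then `∫_{s−1}^s a < M e^{−φ(s−1)}/λ` (`λ ≤ φ'`), and `G(s + 1) ≤ (1 + 32κ/s) G(s)`
  closes the step because `(1 + 32κ/s) log s · e^{1/log(s−1)} ≤ log(s − 1) + log log(s − 1) − log κ`
  for large `s` (`upper_key`);
* **lower barrier** `a(s) ≥ m e^{−ψ(s)}`, `ψ(s) = φ(s) + 2 s log log s / log s`: if it holds on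
  `[s − 1, s)` then `∫_{s−1}^s a ≥ m e^{−ψ(s−1)} (1 − e^{−Λ})/Λ` (`ψ' ≤ Λ`), and `G(x + 1) ≥ G(s)`
  closes the step because `s Λ < κ (1 − e^{−Λ}) e^{λ}` for large `s` (`lower_key`; the gain is the
  factor `e^{2 log log s/log s + 1/log s}` of `e^{λ}`, worth `2 log log s + 1` against the loss
  `log log s − log κ` in `Λ`).

Both propagations are run by the continuation lemma `forall_lt_of_step` (closed bad set, strict
step). Results: `exists_majA_lt_exp` and `exists_exp_lt_majA`, i.e.
`log a(s) = −s log s − s log log s + s log(eκ) + O(s log log s/log s)`; the de Bruijn-type constant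
`2` in `ψ` is not optimal (the true second-order term is `−s (log log s − 1 − log κ)/log s`).
The statements are Iwaniec's; the barrier proofs are the formaliser's (the held copy of the paper
has no text layer).

## References

* H. Iwaniec, *Rosser's sieve*, Acta Arith. 36 (1980), 171–202: §6, Lemma 13 (6.5), Lemmas 15–16.
  [IwaniecActaArith1980]
* G. Greaves, *Sieves in Number Theory*, Springer (2001), §4.3.2 (Lemma 4.3.3 (i):
  `U(s) = O(e^{−s log s})`). [Greaves2001]
-/

open Filter Set MeasureTheory intervalIntegral
open scoped Topology

noncomputable section

namespace Literature.NumberTheory.Sieve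

open SieveAdjoint RosserMajorant BetaSieve

namespace RosserMajorant

variable {κ β : ℝ}

/-! ### Continuous induction on unit steps -/

/-- **Continuation along unit steps**: if `f < g` on `[T − 1, T)`, both are continuous on
`[T, ∞)`, and `f(s) < g(s)` follows from `f < g` on `[s − 1, s)` for every `s ≥ T`, then `f < g` on
`[T − 1, ∞)` (at the infimum `u` of the closed set `{u ≥ T : g(u) ≤ f(u)}` the step applies).
[folklore] -/
theorem forall_lt_of_step {f g : ℝ → ℝ} {T : ℝ} (hf : ContinuousOn f (Ici T))
    (hg : ContinuousOn g (Ici T)) (hbase : ∀ x : ℝ, T - 1 ≤ x → x < T → f x < g x)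
    (hstep : ∀ s : ℝ, T ≤ s → (∀ x : ℝ, s - 1 ≤ x → x < s → f x < g x) → f s < g s) :
    ∀ s : ℝ, T - 1 ≤ s → f s < g s := by
  by_contra hneg
  push Not at hneg
  obtain ⟨s, hs, hsf⟩ := hneg
  set S : Set ℝ := Ici T ∩ (fun u => f u - g u) ⁻¹' (Ici 0) with hSdef
  have hsT : T ≤ s := by
    by_contra h
    push Not at h
    exact absurd (hbase s hs h) (not_lt.mpr hsf)
  have hsS : s ∈ S := ⟨hsT, show 0 ≤ f s - g s by linarith⟩
  have hne : S.Nonempty := ⟨s, hsS⟩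
  have hbdd : BddBelow S := ⟨T, fun u hu => hu.1⟩
  have hclosed : IsClosed S :=
    (hf.sub hg).preimage_isClosed_of_isClosed isClosed_Ici isClosed_Ici
  set u := sInf S with hudef
  have huS : u ∈ S := hclosed.csInf_mem hne hbdd
  have hle_of_mem : ∀ x ∈ S, u ≤ x := fun x hx => csInf_le hbdd hx
  have huT : T ≤ u := huS.1
  have hbelow : ∀ x, u - 1 ≤ x → x < u → f x < g x := by
    intro x hx1 hxu
    rcases lt_or_ge x T with h | h
    · exact hbase x (by linarith) h
    · by_contra hx
      have := hle_of_mem x ⟨h, show 0 ≤ f x - g x by linarith [not_lt.mp hx]⟩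
      linarith
  have h1 := hstep u huS.1 hbelow
  have h2 : 0 ≤ f u - g u := huS.2
  linarith

/-! ### The abstract barrier steps -/

/-- **Upper barrier step.** If `s a(s) ≤ K ∫_{s−1}^s a`, `λ ≤ φ' ≤ Λ` on `(s − 1, s)` with
`λ > 0`, `K e^{Λ} ≤ s λ`, and `a ≤ M e^{−φ}` on `(s − 1, s)`, then `a(s) < M e^{−φ(s)}`:
`∫_{s−1}^s e^{−φ} ≤ e^{−φ(s−1)} (1 − e^{−λ})/λ < e^{−φ(s)} e^{Λ}/λ`. [folklore] -/
theorem upper_barrier_step {a φ φ' : ℝ → ℝ} {s K M lo hi : ℝ} (hs : 0 < s) (hK : 0 < K)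
    (hM : 0 < M) (hpair : s * a s ≤ K * ∫ x in (s - 1)..s, a x)
    (ha : IntervalIntegrable a volume (s - 1) s) (hφc : ContinuousOn φ (Icc (s - 1) s))
    (hφ : ∀ x ∈ Ioo (s - 1) s, HasDerivAt φ (φ' x) x)
    (hlo : ∀ x ∈ Ioo (s - 1) s, lo ≤ φ' x) (hhi : ∀ x ∈ Ioo (s - 1) s, φ' x ≤ hi) (hlo0 : 0 < lo)
    (hkey : K * Real.exp hi ≤ s * lo) (hIH : ∀ x ∈ Ioo (s - 1) s, a x ≤ M * Real.exp (-φ x)) :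
    a s < M * Real.exp (-φ s) := by
  have hdiff : DifferentiableOn ℝ φ (interior (Icc (s - 1) s)) := by
    rw [interior_Icc]; exact fun x hx => (hφ x hx).differentiableAt.differentiableWithinAt
  -- linear bounds for `φ` on `[s - 1, s]`
  have hlow : ∀ x ∈ Icc (s - 1) s, lo * (x - (s - 1)) ≤ φ x - φ (s - 1) := fun x hx =>
    (convex_Icc (s - 1) s).mul_sub_le_image_sub_of_le_deriv hφc hdiff
      (fun y hy => by rw [interior_Icc] at hy; rw [(hφ y hy).deriv]; exact hlo y hy)
      (s - 1) (left_mem_Icc.mpr (by linarith)) x hx hx.1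
  have hupp : φ s - φ (s - 1) ≤ hi * (s - (s - 1)) :=
    (convex_Icc (s - 1) s).image_sub_le_mul_sub_of_deriv_le hφc hdiff
      (fun y hy => by rw [interior_Icc] at hy; rw [(hφ y hy).deriv]; exact hhi y hy)
      (s - 1) (left_mem_Icc.mpr (by linarith)) s (right_mem_Icc.mpr (by linarith)) (by linarith)
  rw [show s - (s - 1) = (1:ℝ) by ring, mul_one] at hupp
  -- `∫ a ≤ M ∫ e^{-φ} ≤ M e^{-φ(s-1)} (1 - e^{-lo})/lo`
  have hcontE : ContinuousOn (fun x => M * Real.exp (-φ x)) (Icc (s - 1) s) :=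
    continuousOn_const.mul hφc.neg.rexp
  have hiE : IntervalIntegrable (fun x => M * Real.exp (-φ x)) volume (s - 1) s :=
    (hcontE.mono (by rw [uIcc_of_le (by linarith)])).intervalIntegrable
  have h1 : ∫ x in (s - 1)..s, a x ≤ ∫ x in (s - 1)..s, M * Real.exp (-φ x) :=
    intervalIntegral.integral_mono_on_of_le_Ioo (by linarith) ha hiE hIH
  have h2 : ∫ x in (s - 1)..s, M * Real.exp (-φ x) ≤
      ∫ x in (s - 1)..s, M * Real.exp (-φ (s - 1)) * Real.exp (-lo * (x - (s - 1))) := by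
    refine intervalIntegral.integral_mono_on (by linarith) hiE ?_ fun x hx => ?_
    · exact ((continuous_const.mul (Real.continuous_exp.comp
        (continuous_const.mul (continuous_id.sub continuous_const)))).intervalIntegrable _ _)
    · rw [mul_assoc, ← Real.exp_add]
      refine mul_le_mul_of_nonneg_left (Real.exp_le_exp.mpr ?_) hM.le
      linarith [hlow x hx]
  have h3 : ∫ x in (s - 1)..s, M * Real.exp (-φ (s - 1)) * Real.exp (-lo * (x - (s - 1))) =
      M * Real.exp (-φ (s - 1)) * ((1 - Real.exp (-lo)) / lo) := by
    rw [intervalIntegral.integral_const_mul]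
    have := integral_exp_neg_mul_sub (u := s - 1) hlo0.ne'
    rw [show s - 1 + 1 = s by ring] at this
    rw [this]
  have h4 : (1 - Real.exp (-lo)) / lo < 1 / lo :=
    div_lt_div_of_pos_right (by linarith [Real.exp_pos (-lo)]) hlo0
  have h5 : Real.exp (-φ (s - 1)) ≤ Real.exp (-φ s) * Real.exp hi := by
    rw [← Real.exp_add]; exact Real.exp_le_exp.mpr (by linarith)
  -- chain
  have hE0 : 0 < M * Real.exp (-φ (s - 1)) := mul_pos hM (Real.exp_pos _)
  have h6 : s * a s < K * (M * Real.exp (-φ (s - 1)) * (1 / lo)) := by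
    calc s * a s ≤ K * ∫ x in (s - 1)..s, a x := hpair
      _ ≤ K * (M * Real.exp (-φ (s - 1)) * ((1 - Real.exp (-lo)) / lo)) := by
          rw [← h3]; exact mul_le_mul_of_nonneg_left (h1.trans h2) hK.le
      _ < K * (M * Real.exp (-φ (s - 1)) * (1 / lo)) :=
          mul_lt_mul_of_pos_left (mul_lt_mul_of_pos_left h4 hE0) hK
  have h7 : K * (M * Real.exp (-φ (s - 1)) * (1 / lo)) ≤ s * (M * Real.exp (-φ s)) := by
    calc K * (M * Real.exp (-φ (s - 1)) * (1 / lo))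
        ≤ K * (M * (Real.exp (-φ s) * Real.exp hi) * (1 / lo)) := by
          refine mul_le_mul_of_nonneg_left (mul_le_mul_of_nonneg_right
            (mul_le_mul_of_nonneg_left h5 hM.le) (by positivity)) hK.le
      _ = (K * Real.exp hi) / lo * (M * Real.exp (-φ s)) := by field_simp
      _ ≤ (s * lo) / lo * (M * Real.exp (-φ s)) :=
          mul_le_mul_of_nonneg_right (div_le_div_of_nonneg_right hkey hlo0.le) (by positivity)
      _ = s * (M * Real.exp (-φ s)) := by rw [mul_div_cancel_right₀ _ hlo0.ne']
  exact lt_of_mul_lt_mul_left (h6.trans_le h7) hs.le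

/-- **Lower barrier step.** If `κ' ∫_{s−1}^s a ≤ s a(s)`, `λ ≤ ψ' ≤ Λ` on `(s − 1, s)` with
`Λ > 0`, `s Λ < κ' (1 − e^{−Λ}) e^{λ}`, and `a ≥ m e^{−ψ}` on `(s − 1, s)`, then
`a(s) > m e^{−ψ(s)}`: `∫_{s−1}^s e^{−ψ} ≥ e^{−ψ(s−1)} (1 − e^{−Λ})/Λ ≥ e^{−ψ(s)} e^{λ} (1 − e^{−Λ})/Λ`.
[folklore] -/
theorem lower_barrier_step {a ψ ψ' : ℝ → ℝ} {s κ' m lo hi : ℝ} (hs : 0 < s) (hκ' : 0 < κ')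
    (hm : 0 < m) (hpair : κ' * ∫ x in (s - 1)..s, a x ≤ s * a s)
    (ha : IntervalIntegrable a volume (s - 1) s) (hψc : ContinuousOn ψ (Icc (s - 1) s))
    (hψ : ∀ x ∈ Ioo (s - 1) s, HasDerivAt ψ (ψ' x) x)
    (hlo : ∀ x ∈ Ioo (s - 1) s, lo ≤ ψ' x) (hhi : ∀ x ∈ Ioo (s - 1) s, ψ' x ≤ hi) (hhi0 : 0 < hi)
    (hkey : s * hi < κ' * (1 - Real.exp (-hi)) * Real.exp lo)
    (hIH : ∀ x ∈ Ioo (s - 1) s, m * Real.exp (-ψ x) ≤ a x) :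
    m * Real.exp (-ψ s) < a s := by
  have hdiff : DifferentiableOn ℝ ψ (interior (Icc (s - 1) s)) := by
    rw [interior_Icc]; exact fun x hx => (hψ x hx).differentiableAt.differentiableWithinAt
  have hupp : ∀ x ∈ Icc (s - 1) s, ψ x - ψ (s - 1) ≤ hi * (x - (s - 1)) := fun x hx =>
    (convex_Icc (s - 1) s).image_sub_le_mul_sub_of_deriv_le hψc hdiff
      (fun y hy => by rw [interior_Icc] at hy; rw [(hψ y hy).deriv]; exact hhi y hy)
      (s - 1) (left_mem_Icc.mpr (by linarith)) x hx hx.1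
  have hlow : lo * (s - (s - 1)) ≤ ψ s - ψ (s - 1) :=
    (convex_Icc (s - 1) s).mul_sub_le_image_sub_of_le_deriv hψc hdiff
      (fun y hy => by rw [interior_Icc] at hy; rw [(hψ y hy).deriv]; exact hlo y hy)
      (s - 1) (left_mem_Icc.mpr (by linarith)) s (right_mem_Icc.mpr (by linarith)) (by linarith)
  rw [show s - (s - 1) = (1:ℝ) by ring, mul_one] at hlow
  have hcontE : ContinuousOn (fun x => m * Real.exp (-ψ x)) (Icc (s - 1) s) :=
    continuousOn_const.mul hψc.neg.rexp
  have hiE : IntervalIntegrable (fun x => m * Real.exp (-ψ x)) volume (s - 1) s :=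
    (hcontE.mono (by rw [uIcc_of_le (by linarith)])).intervalIntegrable
  have h1 : ∫ x in (s - 1)..s, m * Real.exp (-ψ x) ≤ ∫ x in (s - 1)..s, a x :=
    intervalIntegral.integral_mono_on_of_le_Ioo (by linarith) hiE ha hIH
  have h2 : ∫ x in (s - 1)..s, m * Real.exp (-ψ (s - 1)) * Real.exp (-hi * (x - (s - 1))) ≤
      ∫ x in (s - 1)..s, m * Real.exp (-ψ x) := by
    refine intervalIntegral.integral_mono_on (by linarith) ?_ hiE fun x hx => ?_
    · exact ((continuous_const.mul (Real.continuous_exp.comp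
        (continuous_const.mul (continuous_id.sub continuous_const)))).intervalIntegrable _ _)
    · rw [mul_assoc, ← Real.exp_add]
      refine mul_le_mul_of_nonneg_left (Real.exp_le_exp.mpr ?_) hm.le
      linarith [hupp x hx]
  have h3 : ∫ x in (s - 1)..s, m * Real.exp (-ψ (s - 1)) * Real.exp (-hi * (x - (s - 1))) =
      m * Real.exp (-ψ (s - 1)) * ((1 - Real.exp (-hi)) / hi) := by
    rw [intervalIntegral.integral_const_mul]
    have := integral_exp_neg_mul_sub (u := s - 1) hhi0.ne'
    rw [show s - 1 + 1 = s by ring] at this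
    rw [this]
  have h5 : Real.exp (-ψ s) * Real.exp lo ≤ Real.exp (-ψ (s - 1)) := by
    rw [← Real.exp_add]; exact Real.exp_le_exp.mpr (by linarith)
  have hq0 : 0 < (1 - Real.exp (-hi)) / hi :=
    div_pos (by linarith [Real.exp_lt_one_iff.mpr (show -hi < 0 by linarith)]) hhi0
  -- chain: `s · m e^{-ψ s} < κ' m e^{-ψ s} e^{lo} (1 - e^{-hi})/hi ≤ κ' ∫ m e^{-ψ} ≤ κ' ∫ a ≤ s a(s)`
  have h6 : s * (m * Real.exp (-ψ s)) <
      κ' * (m * (Real.exp (-ψ s) * Real.exp lo) * ((1 - Real.exp (-hi)) / hi)) := by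
    have e : κ' * (m * (Real.exp (-ψ s) * Real.exp lo) * ((1 - Real.exp (-hi)) / hi)) =
        (κ' * (1 - Real.exp (-hi)) * Real.exp lo) / hi * (m * Real.exp (-ψ s)) := by
      field_simp
    rw [e]
    have : s = s * hi / hi := by field_simp
    rw [this]
    exact mul_lt_mul_of_pos_right (div_lt_div_of_pos_right hkey hhi0) (by positivity)
  have h7 : κ' * (m * (Real.exp (-ψ s) * Real.exp lo) * ((1 - Real.exp (-hi)) / hi)) ≤
      s * a s := by
    calc κ' * (m * (Real.exp (-ψ s) * Real.exp lo) * ((1 - Real.exp (-hi)) / hi))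
        ≤ κ' * (m * Real.exp (-ψ (s - 1)) * ((1 - Real.exp (-hi)) / hi)) := by
          refine mul_le_mul_of_nonneg_left (mul_le_mul_of_nonneg_right
            (mul_le_mul_of_nonneg_left h5 hm.le) hq0.le) hκ'.le
      _ = κ' * ∫ x in (s - 1)..s, m * Real.exp (-ψ (s - 1)) * Real.exp (-hi * (x - (s - 1))) := by
          rw [h3]
      _ ≤ κ' * ∫ x in (s - 1)..s, a x := mul_le_mul_of_nonneg_left (h2.trans h1) hκ'.le
      _ ≤ s * a s := hpair
  exact lt_of_mul_lt_mul_left (h6.trans_le h7) hs.le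

/-! ### The barrier exponents `φ` and `ψ = φ + 2 s log log s / log s` -/

/-- **`φ'`**: the derivative of `φ(x) = x log x + x log log x − x log(eκ)` is
`log x + log log x + 1/log x − log κ` (`x > 1`, `κ > 0`). [folklore] -/
theorem hasDerivAt_phi (hκ : 0 < κ) {x : ℝ} (hx : 1 < x) :
    HasDerivAt (fun x => x * Real.log x + x * Real.log (Real.log x) - x * Real.log (Real.exp 1 * κ))
      (Real.log x + Real.log (Real.log x) + 1 / Real.log x - Real.log κ) x := by
  have hx0 : x ≠ 0 := ne_of_gt (by linarith)
  have hl0 : Real.log x ≠ 0 := ne_of_gt (Real.log_pos hx)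
  have h1 : HasDerivAt (fun x => x * Real.log x) (Real.log x + 1) x := Real.hasDerivAt_mul_log hx0
  have h2 : HasDerivAt (fun x => Real.log (Real.log x)) (x⁻¹ / Real.log x) x :=
    (Real.hasDerivAt_log hx0).log hl0
  have h3 : HasDerivAt (fun x => x * Real.log (Real.log x))
      (1 * Real.log (Real.log x) + x * (x⁻¹ / Real.log x)) x := (hasDerivAt_id x).mul h2
  have h4 : HasDerivAt (fun x => x * Real.log (Real.exp 1 * κ)) (1 * Real.log (Real.exp 1 * κ)) x :=
    (hasDerivAt_id x).mul_const _
  have h := (h1.add h3).sub h4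
  refine h.congr_deriv ?_
  rw [Real.log_mul (Real.exp_pos 1).ne' hκ.ne', Real.log_exp]
  field_simp
  ring

/-- **`ψ'`**: the derivative of `ψ(x) = φ(x) + 2 x log log x / log x` is
`φ'(x) + 2 (log log x / log x + (1 − log log x)/(log x)²)` (`x > 1`). [folklore] -/
theorem hasDerivAt_psi (hκ : 0 < κ) {x : ℝ} (hx : 1 < x) :
    HasDerivAt (fun x => x * Real.log x + x * Real.log (Real.log x) - x * Real.log (Real.exp 1 * κ) +
        2 * (x * Real.log (Real.log x) / Real.log x))
      (Real.log x + Real.log (Real.log x) + 1 / Real.log x - Real.log κ +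
        2 * (Real.log (Real.log x) / Real.log x + (1 - Real.log (Real.log x)) / Real.log x ^ 2)) x := by
  have hx0 : x ≠ 0 := ne_of_gt (by linarith)
  have hl0 : Real.log x ≠ 0 := ne_of_gt (Real.log_pos hx)
  have h2 : HasDerivAt (fun x => Real.log (Real.log x)) (x⁻¹ / Real.log x) x :=
    (Real.hasDerivAt_log hx0).log hl0
  have h3 : HasDerivAt (fun x => x * Real.log (Real.log x))
      (1 * Real.log (Real.log x) + x * (x⁻¹ / Real.log x)) x := (hasDerivAt_id x).mul h2
  have h5 : HasDerivAt (fun x => x * Real.log (Real.log x) / Real.log x)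
      (((1 * Real.log (Real.log x) + x * (x⁻¹ / Real.log x)) * Real.log x -
        x * Real.log (Real.log x) * x⁻¹) / Real.log x ^ 2) x :=
    h3.div (Real.hasDerivAt_log hx0) hl0
  have h := (hasDerivAt_phi hκ hx).add (h5.const_mul 2)
  refine h.congr_deriv ?_
  field_simp
  ring

/-- `φ` is continuous on `(1, ∞)`. [folklore] -/
theorem continuousOn_phi (hκ : 0 < κ) :
    ContinuousOn (fun x => x * Real.log x + x * Real.log (Real.log x) - x * Real.log (Real.exp 1 * κ))
      (Ioi 1) :=
  fun _ hx => (hasDerivAt_phi hκ hx).continuousAt.continuousWithinAt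

/-- `ψ` is continuous on `(1, ∞)`. [folklore] -/
theorem continuousOn_psi (hκ : 0 < κ) :
    ContinuousOn (fun x => x * Real.log x + x * Real.log (Real.log x) - x * Real.log (Real.exp 1 * κ) +
        2 * (x * Real.log (Real.log x) / Real.log x)) (Ioi 1) :=
  fun _ hx => (hasDerivAt_psi hκ hx).continuousAt.continuousWithinAt

/-- **Bounds for `φ'` on `(s − 1, s)`** (`s − 1 ≥ e`):
`log(s−1) + log log(s−1) − log κ ≤ φ'(x) ≤ log s + log log s + 1/log(s−1) − log κ`. [folklore] -/
theorem phi_deriv_bounds {s x : ℝ} (hs : Real.exp 1 + 1 ≤ s) (hx : x ∈ Ioo (s - 1) s) :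
    Real.log (s - 1) + Real.log (Real.log (s - 1)) - Real.log κ ≤
        Real.log x + Real.log (Real.log x) + 1 / Real.log x - Real.log κ ∧
      Real.log x + Real.log (Real.log x) + 1 / Real.log x - Real.log κ ≤
        Real.log s + Real.log (Real.log s) + 1 / Real.log (s - 1) - Real.log κ := by
  have he : 0 < Real.exp 1 := Real.exp_pos 1
  have hs1 : Real.exp 1 ≤ s - 1 := by linarith
  have hl1 : 1 ≤ Real.log (s - 1) := by
    have h := Real.log_le_log he hs1; rwa [Real.log_exp] at h
  have hx1 : Real.log (s - 1) ≤ Real.log x := Real.log_le_log (by linarith) hx.1.le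
  have hx2 : Real.log x ≤ Real.log s := Real.log_le_log (by linarith [hx.1]) hx.2.le
  have hlx : 0 < Real.log x := by linarith
  have hll1 : Real.log (Real.log (s - 1)) ≤ Real.log (Real.log x) := Real.log_le_log (by linarith) hx1
  have hll2 : Real.log (Real.log x) ≤ Real.log (Real.log s) := Real.log_le_log hlx hx2
  have hinv1 : 0 < 1 / Real.log x := by positivity
  have hinv2 : 1 / Real.log x ≤ 1 / Real.log (s - 1) :=
    one_div_le_one_div_of_le (by linarith) hx1
  constructor <;> linarith

/-- **Bounds for `ψ'` on `(s − 1, s)`** (`s − 1 ≥ e^e`, so that `log log x ≥ 1`): with `y = log(s−1)`,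
`ℓ = log s`: `y + log y + 1/ℓ − log κ + 2 log y/ℓ + 2 (1 − log ℓ)/y² ≤ ψ'(x) ≤
ℓ + log ℓ + 1/y − log κ + 2 log ℓ/y`. [folklore] -/
theorem psi_deriv_bounds {s x : ℝ} (hs : Real.exp (Real.exp 1) + 1 ≤ s) (hx : x ∈ Ioo (s - 1) s) :
    Real.log (s - 1) + Real.log (Real.log (s - 1)) + 1 / Real.log s - Real.log κ +
        2 * (Real.log (Real.log (s - 1)) / Real.log s +
          (1 - Real.log (Real.log s)) / Real.log (s - 1) ^ 2) ≤
      Real.log x + Real.log (Real.log x) + 1 / Real.log x - Real.log κ +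
        2 * (Real.log (Real.log x) / Real.log x + (1 - Real.log (Real.log x)) / Real.log x ^ 2) ∧
    Real.log x + Real.log (Real.log x) + 1 / Real.log x - Real.log κ +
        2 * (Real.log (Real.log x) / Real.log x + (1 - Real.log (Real.log x)) / Real.log x ^ 2) ≤
      Real.log s + Real.log (Real.log s) + 1 / Real.log (s - 1) - Real.log κ +
        2 * (Real.log (Real.log s) / Real.log (s - 1)) := by
  have he : 0 < Real.exp 1 := Real.exp_pos 1
  have he1 : 1 ≤ Real.exp 1 := by have := Real.add_one_le_exp (1:ℝ); linarith
  have hee : Real.exp 1 ≤ Real.exp (Real.exp 1) := Real.exp_le_exp.mpr he1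
  have hs1 : Real.exp (Real.exp 1) ≤ s - 1 := by linarith
  -- `y = log (s-1) ≥ e`, `log y ≥ 1`
  have hy : Real.exp 1 ≤ Real.log (s - 1) := by
    have h := Real.log_le_log (Real.exp_pos _) hs1; rwa [Real.log_exp] at h
  have hy1 : 1 ≤ Real.log (s - 1) := he1.trans hy
  have hly : 1 ≤ Real.log (Real.log (s - 1)) := by
    have h := Real.log_le_log he hy; rwa [Real.log_exp] at h
  have hx1 : Real.log (s - 1) ≤ Real.log x := Real.log_le_log (by linarith) hx.1.le
  have hx2 : Real.log x ≤ Real.log s := Real.log_le_log (by linarith [hx.1]) hx.2.le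
  have hlx : 0 < Real.log x := by linarith
  have hls : 0 < Real.log s := by linarith
  have hll1 : Real.log (Real.log (s - 1)) ≤ Real.log (Real.log x) := Real.log_le_log (by linarith) hx1
  have hll2 : Real.log (Real.log x) ≤ Real.log (Real.log s) := Real.log_le_log hlx hx2
  have hinv1 : 1 / Real.log s ≤ 1 / Real.log x := one_div_le_one_div_of_le hlx hx2
  have hinv2 : 1 / Real.log x ≤ 1 / Real.log (s - 1) := one_div_le_one_div_of_le (by linarith) hx1
  -- the ratio `log log x / log x`
  have hr1 : Real.log (Real.log (s - 1)) / Real.log s ≤ Real.log (Real.log x) / Real.log x :=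
    div_le_div₀ (by linarith) hll1 hlx hx2
  have hr2 : Real.log (Real.log x) / Real.log x ≤ Real.log (Real.log s) / Real.log (s - 1) :=
    div_le_div₀ (by linarith) hll2 (by linarith) hx1
  -- the term `(1 - log log x)/(log x)^2 ∈ [(1 - log log s)/(log (s-1))^2, 0]`
  have hN0 : 1 - Real.log (Real.log x) ≤ 0 := by linarith
  have hq2 : (1 - Real.log (Real.log x)) / Real.log x ^ 2 ≤ 0 :=
    div_nonpos_of_nonpos_of_nonneg hN0 (by positivity)
  have hq1 : (1 - Real.log (Real.log s)) / Real.log (s - 1) ^ 2 ≤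
      (1 - Real.log (Real.log x)) / Real.log x ^ 2 := by
    have hD1 : 0 < Real.log (s - 1) ^ 2 := by positivity
    have hDx : Real.log (s - 1) ^ 2 ≤ Real.log x ^ 2 := by nlinarith
    calc (1 - Real.log (Real.log s)) / Real.log (s - 1) ^ 2
        ≤ (1 - Real.log (Real.log x)) / Real.log (s - 1) ^ 2 :=
          div_le_div_of_nonneg_right (by linarith) hD1.le
      _ ≤ (1 - Real.log (Real.log x)) / Real.log x ^ 2 := by
          rw [div_le_div_iff₀ hD1 (by positivity)]
          nlinarith
  constructor <;> nlinarith

/-! ### The two key numerical inequalities -/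

/-- `y²/2 ≤ e^y` for `y ≥ 0`. [folklore] -/
theorem sq_div_two_le_exp {y : ℝ} (hy : 0 ≤ y) : y ^ 2 / 2 ≤ Real.exp y := by
  have h := Real.pow_div_factorial_le_exp (x := y) hy 2
  norm_num [Nat.factorial] at h
  exact h

/-- **The key inequality of the upper barrier**: for `y ≥ max(1, 12A, κ e⁶)`, `y ≤ ℓ ≤ y + 1` and
`s ≥ e^y`, `(1 + A/s) ℓ e^{1/y} ≤ y + log y − log κ`. [folklore] -/
theorem upper_key (hκ : 0 < κ) {A y ℓ s : ℝ} (hA : 0 ≤ A) (hy1 : 1 ≤ y) (hyA : 12 * A ≤ y)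
    (hyκ : κ * Real.exp 6 ≤ y) (hℓ1 : y ≤ ℓ) (hℓ2 : ℓ ≤ y + 1) (hsy : Real.exp y ≤ s) :
    (1 + A / s) * ℓ * Real.exp (1 / y) ≤ y + Real.log y - Real.log κ := by
  have hy0 : 0 < y := by linarith
  have hs0 : 0 < s := lt_of_lt_of_le (Real.exp_pos y) hsy
  -- `e^{1/y} ≤ 1 + 2/y`, `ℓ e^{1/y} ≤ y + 5`
  have h1 : Real.exp (1 / y) ≤ 1 + 2 * (1 / y) := by
    -- `e^t ≤ 1 + 2t` for `0 ≤ t ≤ 1`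
    have ht0 : 0 ≤ 1 / y := by positivity
    have ht1 : 1 / y ≤ 1 := by rw [div_le_one hy0]; exact hy1
    have h := Real.abs_exp_sub_one_le (x := 1 / y) (by rw [abs_of_nonneg ht0]; exact ht1)
    rw [abs_of_nonneg ht0] at h
    linarith [(abs_le.mp h).2]
  have h2 : ℓ * Real.exp (1 / y) ≤ y + 5 := by
    calc ℓ * Real.exp (1 / y) ≤ (y + 1) * (1 + 2 * (1 / y)) :=
          mul_le_mul hℓ2 h1 (Real.exp_pos _).le (by linarith)
      _ = y + 3 + 2 / y := by field_simp; ring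
      _ ≤ y + 5 := by
          have : 2 / y ≤ 2 := by rw [div_le_iff₀ hy0]; linarith
          linarith
  -- `A/s ≤ 2A/y²`
  have h3 : A / s ≤ 2 * A / y ^ 2 := by
    have : y ^ 2 / 2 ≤ s := (sq_div_two_le_exp hy0.le).trans hsy
    calc A / s ≤ A / (y ^ 2 / 2) := div_le_div_of_nonneg_left hA (by positivity) this
      _ = 2 * A / y ^ 2 := by field_simp
  -- combine: `(1 + A/s)(y + 5) ≤ y + 5 + 2A(y+5)/y² ≤ y + 5 + 12A/y ≤ y + 6`
  have h4 : (1 + A / s) * ℓ * Real.exp (1 / y) ≤ y + 6 := by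
    have hpos : 0 ≤ 1 + A / s := by positivity
    calc (1 + A / s) * ℓ * Real.exp (1 / y) = (1 + A / s) * (ℓ * Real.exp (1 / y)) := by ring
      _ ≤ (1 + 2 * A / y ^ 2) * (y + 5) :=
          mul_le_mul (by linarith) h2 (mul_nonneg (by linarith) (Real.exp_pos _).le) (by positivity)
      _ = y + 5 + 2 * A * (y + 5) / y ^ 2 := by field_simp
      _ ≤ y + 5 + 12 * A / y := by
          have : 2 * A * (y + 5) / y ^ 2 ≤ 12 * A / y := by
            rw [div_le_div_iff₀ (by positivity) hy0]
            have hAy : 0 ≤ A * y * (y - 1) := mul_nonneg (mul_nonneg hA hy0.le) (by linarith)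
            have : 12 * A * y ^ 2 - 2 * A * (y + 5) * y = 10 * (A * y * (y - 1)) := by ring
            nlinarith
          linarith
      _ ≤ y + 6 := by
          have : 12 * A / y ≤ 1 := by rw [div_le_one hy0]; exact hyA
          linarith
  -- `log y ≥ 6 + log κ`
  have h5 : 6 + Real.log κ ≤ Real.log y := by
    have := Real.log_le_log (by positivity) hyκ
    rwa [Real.log_mul hκ.ne' (Real.exp_pos 6).ne', Real.log_exp, add_comm] at this
  linarith

/-- **The key inequality of the lower barrier**: for `y` large in terms of `κ`,
`y ≤ ℓ ≤ y + e^{−y}`, with `λ = y + log y + 1/ℓ − log κ + 2 log y/ℓ + 2(1 − log ℓ)/y²` and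
`Λ = ℓ + log ℓ + 1/y − log κ + 2 log ℓ/y`: `(e^y + 1) Λ < κ (1 − e^{−Λ}) e^{λ}`. [folklore] -/
theorem lower_key (hκ : 0 < κ) {y ℓ lo hi : ℝ} (hy1 : 1024 ≤ y) (hylog : |Real.log κ| ≤ Real.log y)
    (hyK : 4 * (9 + |Real.log κ| + 6 * κ) + 1 ≤ y) (hyκ : 2 * κ + 1 ≤ y)
    (hℓ1 : y ≤ ℓ) (hℓ2 : ℓ ≤ y + Real.exp (-y))
    (hlo : lo = y + Real.log y + 1 / ℓ - Real.log κ + 2 * (Real.log y / ℓ) +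
      2 * ((1 - Real.log ℓ) / y ^ 2))
    (hhi : hi = ℓ + Real.log ℓ + 1 / y - Real.log κ + 2 * (Real.log ℓ / y)) :
    (Real.exp y + 1) * hi < κ * (1 - Real.exp (-hi)) * Real.exp lo := by
  have hy0 : 0 < y := by linarith
  have hy1' : 1 ≤ y := by linarith
  have hℓ0 : 0 < ℓ := by linarith
  have hℓy1 : 1 ≤ ℓ := by linarith
  -- small polynomial facts, proved while the context is small
  have hy2 : 1 ≤ y ^ 2 := by nlinarith only [hy1']
  have h4κ : 4 * κ ≤ y ^ 2 := by nlinarith only [hyκ, hκ]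
  have hy2000 : (2000:ℝ) ≤ y ^ 2 := by nlinarith only [hy1]
  -- `E = e^{-y}`, `δ = ℓ - y`
  have hE2 : Real.exp (-y) ≤ 2 / y ^ 2 := by
    have h := sq_div_two_le_exp hy0.le
    rw [Real.exp_neg, inv_eq_one_div, div_le_div_iff₀ (Real.exp_pos y) (by positivity)]
    nlinarith only [h, hy0]
  have hE1 : Real.exp (-y) ≤ 1 := Real.exp_le_one_iff.mpr (by linarith)
  have hEy : Real.exp (-y) * Real.exp y = 1 := by rw [← Real.exp_add, neg_add_cancel, Real.exp_zero]
  obtain ⟨δ, hδ⟩ : ∃ δ : ℝ, δ = ℓ - y := ⟨_, rfl⟩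
  have hδ0 : 0 ≤ δ := by rw [hδ]; linarith
  have hδE : δ ≤ Real.exp (-y) := by rw [hδ]; linarith
  have hδsmall : δ ≤ 1 / 1000 := by
    calc δ ≤ 2 / y ^ 2 := hδE.trans hE2
      _ ≤ 1 / 1000 := by
          rw [div_le_div_iff₀ (by positivity) (by norm_num)]; linarith only [hy2000]
  have hℓδ : ℓ = y + δ := by rw [hδ]; ring
  have hlogy0 : 0 ≤ Real.log y := Real.log_nonneg hy1'
  have hlogy1 : Real.log y ≤ y - 1 := Real.log_le_sub_one_of_pos hy0
  have hlogy : Real.log y ≤ y := hlogy1.trans (by linarith)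
  have hlogℓ0 : 0 ≤ Real.log ℓ := Real.log_nonneg hℓy1
  have hlogℓ : Real.log ℓ ≤ ℓ := (Real.log_le_sub_one_of_pos hℓ0).trans (by linarith)
  have hlk : -Real.log y ≤ Real.log κ := by linarith [neg_abs_le (Real.log κ)]
  have hlk' : -Real.log κ ≤ |Real.log κ| := neg_le_abs _
  have habs0 : 0 ≤ |Real.log κ| := abs_nonneg _
  -- bounds for the atoms `1/y`, `log y / y`, `δ/y²`, `δ/y`
  have hr50 : 0 < 1 / y := by positivity
  have hr51 : 1 / y ≤ 1 := by rw [div_le_one hy0]; exact hy1'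
  have hr6b : Real.log y / y ≤ 1 / 16 := by
    -- `log y ≤ 2 √y`
    have hs : Real.log y ≤ 2 * Real.sqrt y := by
      have h := Real.log_le_sub_one_of_pos (Real.sqrt_pos.mpr hy0)
      rw [Real.log_sqrt hy0.le] at h
      linarith [Real.sqrt_nonneg y]
    have hsq : (32:ℝ) ≤ Real.sqrt y := by
      rw [show (32:ℝ) = Real.sqrt (32 ^ 2) by rw [Real.sqrt_sq (by norm_num)]]
      exact Real.sqrt_le_sqrt (by norm_num; linarith)
    rw [div_le_div_iff₀ hy0 (by norm_num)]
    have hyy : Real.sqrt y * Real.sqrt y = y := Real.mul_self_sqrt hy0.le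
    nlinarith [Real.sqrt_nonneg y]
  have hr60 : 0 ≤ Real.log y / y := by positivity
  have hr7δ : δ / y ^ 2 ≤ δ := div_le_self hδ0 hy2
  have hr70 : 0 ≤ δ / y ^ 2 := by positivity
  have hr8δ : δ / y ≤ δ := div_le_self hδ0 hy1'
  have hr80 : 0 ≤ δ / y := by positivity
  -- `log ℓ ≤ log y + δ/y` and the atoms `log ℓ / y`, `y/ℓ`, `y log y/ℓ`, `(1 - log ℓ)/y`
  have hb4 : Real.log ℓ ≤ Real.log y + δ / y := by
    have h := Real.log_le_sub_one_of_pos (show 0 < ℓ / y by positivity)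
    rw [Real.log_div hℓ0.ne' hy0.ne'] at h
    have : ℓ / y - 1 = δ / y := by rw [hδ]; field_simp
    linarith
  have hb5 : Real.log ℓ / y ≤ Real.log y / y + δ / y ^ 2 := by
    have := div_le_div_of_nonneg_right hb4 hy0.le
    rw [add_div] at this
    have e : δ / y / y = δ / y ^ 2 := by rw [div_div, sq]
    linarith
  have hr40 : 0 ≤ Real.log ℓ / y := by positivity
  have hb1 : 1 - δ ≤ y / ℓ := by
    rw [le_div_iff₀ hℓ0, hℓδ]
    have : 0 ≤ δ * (y + δ - 1) := mul_nonneg hδ0 (by linarith)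
    linarith only [this]
  have hr11 : y / ℓ ≤ 1 := (div_le_one hℓ0).mpr hℓ1
  have hb2 : Real.log y - δ ≤ y * Real.log y / ℓ := by
    rw [le_div_iff₀ hℓ0, hℓδ]
    have : 0 ≤ δ * (y + δ - Real.log y) := mul_nonneg hδ0 (by linarith)
    linarith only [this]
  have hr2b : y * Real.log y / ℓ ≤ Real.log y := by
    rw [div_le_iff₀ hℓ0]
    exact mul_le_mul_of_nonneg_right hℓ1 hlogy0 |>.trans_eq (mul_comm _ _)
  have hb3 : 1 / y - Real.log y / y - δ / y ^ 2 ≤ (1 - Real.log ℓ) / y := by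
    have := div_le_div_of_nonneg_right
      (show 1 - Real.log y - δ / y ≤ 1 - Real.log ℓ by linarith) hy0.le
    have e : (1 - Real.log y - δ / y) / y = 1 / y - Real.log y / y - δ / y ^ 2 := by
      rw [sub_div, sub_div, div_div, sq]
    linarith
  have hr3b : (1 - Real.log ℓ) / y ≤ 1 / y := div_le_div_of_nonneg_right (by linarith) hy0.le
  -- `P = y (1 + E₁)` with `lo = y + log y - log κ + E₁`
  obtain ⟨P, hP⟩ : ∃ P : ℝ, P = y + y / ℓ + 2 * (y * Real.log y / ℓ) + 2 * ((1 - Real.log ℓ) / y) :=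
    ⟨_, rfl⟩
  obtain ⟨E₁, hE₁⟩ : ∃ E₁ : ℝ, E₁ = 1 / ℓ + 2 * (Real.log y / ℓ) + 2 * ((1 - Real.log ℓ) / y ^ 2) :=
    ⟨_, rfl⟩
  have hlo' : lo = (y + Real.log y - Real.log κ) + E₁ := by rw [hlo, hE₁]; ring
  have hyE₁ : y * (1 + E₁) = P := by
    rw [hE₁, hP]; field_simp; ring
  -- Step A: `κ e^{lo} ≥ e^y P`
  have hA : Real.exp y * P ≤ κ * Real.exp lo := by
    rw [hlo', Real.exp_add, Real.exp_sub, Real.exp_add, Real.exp_log hy0, Real.exp_log hκ]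
    have h1 : 1 + E₁ ≤ Real.exp E₁ := by linarith [Real.add_one_le_exp E₁]
    have h2 : Real.exp y * P = Real.exp y * y * (1 + E₁) := by rw [← hyE₁]; ring
    rw [h2]
    have h3 : κ * (Real.exp y * y / κ * Real.exp E₁) = Real.exp y * y * Real.exp E₁ := by
      field_simp
    rw [h3]
    exact mul_le_mul_of_nonneg_left h1 (by positivity)
  -- Step B: `e^{-hi} ≤ κ e^{-y}`
  have hhi_ge : y - Real.log κ ≤ hi := by rw [hhi]; linarith
  have hB : Real.exp (-hi) ≤ κ * Real.exp (-y) := by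
    calc Real.exp (-hi) ≤ Real.exp (-(y - Real.log κ)) := Real.exp_le_exp.mpr (by linarith)
      _ = κ * Real.exp (-y) := by
          rw [show -(y - Real.log κ) = Real.log κ + -y by ring, Real.exp_add, Real.exp_log hκ]
  -- Step C: signs and `κ (1 - e^{-hi}) e^{lo} ≥ e^y P - κ P`
  have hκE : κ * Real.exp (-y) ≤ 1 / 2 := by
    calc κ * Real.exp (-y) ≤ κ * (2 / y ^ 2) := mul_le_mul_of_nonneg_left hE2 hκ.le
      _ ≤ 1 / 2 := by
          rw [mul_div_assoc', div_le_div_iff₀ (by positivity) (by norm_num)]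
          linarith only [h4κ]
  have hP0 : 0 ≤ P := by
    rw [hP]; linarith only [hb1, hb2, hb3, hδsmall, hr50, hr6b, hr7δ, hlogy0, hy1]
  have hhi0 : 0 < hi := by
    have : Real.log κ ≤ |Real.log κ| := le_abs_self _
    linarith only [hhi_ge, this, hylog, hlogy1]
  have hC : Real.exp y * P - κ * P ≤ κ * (1 - Real.exp (-hi)) * Real.exp lo := by
    have h1 : (1 - κ * Real.exp (-y)) * (Real.exp y * P) ≤
        (1 - Real.exp (-hi)) * (κ * Real.exp lo) :=
      mul_le_mul (by linarith) hA (by positivity) (by linarith [Real.exp_pos (-hi), hB])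
    have h2 : (1 - κ * Real.exp (-y)) * (Real.exp y * P) = Real.exp y * P - κ * P := by
      have : κ * Real.exp (-y) * (Real.exp y * P) = κ * P * (Real.exp (-y) * Real.exp y) := by ring
      rw [sub_mul, one_mul, this, hEy, mul_one]
    rw [h2] at h1
    linarith
  -- Step E: `P - hi ≥ 1/2`
  have hE_ : 1 / 2 ≤ P - hi := by
    rw [hP, hhi]
    linarith only [hℓδ, hb1, hb2, hb3, hb4, hb5, hlk, hr6b, hr7δ, hr8δ, hδsmall, hr50]
  -- Step F: `hi + κ P ≤ K y`
  have hF : hi + κ * P ≤ (9 + |Real.log κ| + 6 * κ) * y := by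
    have hk : |Real.log κ| ≤ |Real.log κ| * y := le_mul_of_one_le_right habs0 hy1'
    have hℓ1' : ℓ ≤ y + 1 := by linarith only [hℓ2, hE1]
    have hr4b : Real.log ℓ / y ≤ 2 := by
      rw [div_le_iff₀ hy0]; linarith only [hlogℓ, hℓ1', hy1']
    have h1 : hi ≤ (9 + |Real.log κ|) * y := by
      rw [hhi]
      linarith only [hℓ1', hlogℓ, hr51, hlk', hr4b, hk, hy1']
    have h2 : P ≤ 6 * y := by rw [hP]; linarith only [hr11, hr2b, hlogy, hr3b, hr51, hy1']
    have h3 := mul_le_mul_of_nonneg_left h2 hκ.le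
    linarith only [h1, h3]
  -- Step G: `e^y (P - hi) > hi + κ P`
  have hey : y ^ 2 / 2 ≤ Real.exp y := sq_div_two_le_exp hy0.le
  have hG : hi + κ * P < Real.exp y * P - Real.exp y * hi := by
    have h1 : y ^ 2 / 2 * (1 / 2) ≤ Real.exp y * (P - hi) :=
      mul_le_mul hey hE_ (by norm_num) (Real.exp_pos y).le
    have h2 : (9 + |Real.log κ| + 6 * κ) * y < y ^ 2 / 2 * (1 / 2) := by
      have h4 := mul_le_mul_of_nonneg_right hyK hy0.le
      linarith only [h4, hy0]
    have h3 : Real.exp y * (P - hi) = Real.exp y * P - Real.exp y * hi := by ring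
    linarith only [h1, h2, h3, hF]
  -- conclude
  calc (Real.exp y + 1) * hi = Real.exp y * hi + hi := by ring
    _ < Real.exp y * P - κ * P := by linarith only [hG]
    _ ≤ _ := hC

/-! ### The barriers for `a = majA` -/

section Main

variable (hκ : 0 < κ) (hβ : 1 < β) (h0 : qFun κ (β - 1) = 0)
  (hg : ∀ x : ℝ, β - 1 < x → 0 < qFun κ x)
include hκ hβ h0 hg

/-- **(6.12) as an upper bound**: `s a(s) ≤ κ (1 + 32κ/s) ∫_{s−1}^s a` for large `s`
(`G(x + 1) ≤ G(s + 1) ≤ (1 + 32κ/s) G(s)`). [cite: IwaniecActaArith1980, §6 (6.12)] -/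
theorem mul_majA_le_integral {s₁ s : ℝ}
    (hG : ∀ t : ℝ, s₁ ≤ t → adjG κ β (t + 1) ≤ (1 + 32 * κ / t) * adjG κ β t)
    (hs₁ : s₁ ≤ s) (hsβ : β + 2 ≤ s) :
    s * majA κ β s ≤ κ * (1 + 32 * κ / s) * ∫ x in (s - 1)..s, majA κ β x := by
  have hs0 : 0 < s := by linarith
  have hGs : 0 < adjG κ β s := adjG_pos hκ hβ hg (by linarith)
  have hPair := pairA_eq_zero hκ hβ h0 (by linarith : β + 1 ≤ s)
  rw [sieveInnerProduct] at hPair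
  have hcontA : ContinuousOn (majA κ β) (Icc (s - 1) s) :=
    (continuousOn_majA hβ).mono fun x hx => show (0:ℝ) < x by linarith [hx.1]
  have hiA : IntervalIntegrable (majA κ β) volume (s - 1) s :=
    (hcontA.mono (by rw [uIcc_of_le (by linarith)])).intervalIntegrable
  have hcontF : ContinuousOn (fun x => adjG κ β (x + 1) * majA κ β x) (Icc (s - 1) s) :=
    ((continuousOn_comp_add_one (continuousOn_adjG hβ)).mono fun x hx =>
      show (0:ℝ) < x by linarith [hx.1]).mul hcontA
  have hmonoF : ∫ x in (s - 1)..s, adjG κ β (x + 1) * majA κ β x ≤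
      ∫ x in (s - 1)..s, adjG κ β (s + 1) * majA κ β x := by
    refine intervalIntegral.integral_mono_on (by linarith)
      (hcontF.mono (by rw [uIcc_of_le (by linarith)])).intervalIntegrable (hiA.const_mul _)
      fun x hx => ?_
    exact mul_le_mul_of_nonneg_right (adjG_le_adjG hκ hβ hg (by linarith [hx.1]) (by linarith [hx.2]))
      (majA_pos hκ hβ h0 hg (by linarith [hx.1])).le
  rw [intervalIntegral.integral_const_mul] at hmonoF
  have hint0 : 0 ≤ ∫ x in (s - 1)..s, majA κ β x :=
    intervalIntegral.integral_nonneg (by linarith) fun x hx => (majA_pos hκ hβ h0 hg (by linarith [hx.1])).le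
  have h1 : s * adjG κ β s * majA κ β s ≤ κ * (adjG κ β (s + 1) * ∫ x in (s - 1)..s, majA κ β x) := by
    have : s * adjG κ β s * majA κ β s = κ * ∫ x in (s - 1)..s, adjG κ β (x + 1) * majA κ β x := by
      linarith
    rw [this]; exact mul_le_mul_of_nonneg_left hmonoF hκ.le
  have h2 : adjG κ β (s + 1) * ∫ x in (s - 1)..s, majA κ β x ≤
      (1 + 32 * κ / s) * adjG κ β s * ∫ x in (s - 1)..s, majA κ β x :=
    mul_le_mul_of_nonneg_right (hG s hs₁) hint0
  have h3 : adjG κ β s * (s * majA κ β s) ≤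
      adjG κ β s * (κ * (1 + 32 * κ / s) * ∫ x in (s - 1)..s, majA κ β x) := by
    nlinarith [mul_le_mul_of_nonneg_left h2 hκ.le]
  exact le_of_mul_le_mul_left h3 hGs

/-- **(6.12) as a lower bound**: `κ ∫_{s−1}^s a ≤ s a(s)` for `s ≥ β + 1` (`G(x + 1) ≥ G(s)`).
[cite: IwaniecActaArith1980, §6 (6.12)] -/
theorem integral_majA_le {s : ℝ} (hs : β + 1 ≤ s) :
    κ * ∫ x in (s - 1)..s, majA κ β x ≤ s * majA κ β s := by
  have hs0 : 0 < s := by linarith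
  have hGs : 0 < adjG κ β s := adjG_pos hκ hβ hg (by linarith)
  have hPair := pairA_eq_zero hκ hβ h0 hs
  rw [sieveInnerProduct] at hPair
  have hcontA : ContinuousOn (majA κ β) (Icc (s - 1) s) :=
    (continuousOn_majA hβ).mono fun x hx => show (0:ℝ) < x by linarith [hx.1]
  have hiA : IntervalIntegrable (majA κ β) volume (s - 1) s :=
    (hcontA.mono (by rw [uIcc_of_le (by linarith)])).intervalIntegrable
  have hcontF : ContinuousOn (fun x => adjG κ β (x + 1) * majA κ β x) (Icc (s - 1) s) :=
    ((continuousOn_comp_add_one (continuousOn_adjG hβ)).mono fun x hx =>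
      show (0:ℝ) < x by linarith [hx.1]).mul hcontA
  have hmonoF : ∫ x in (s - 1)..s, adjG κ β s * majA κ β x ≤
      ∫ x in (s - 1)..s, adjG κ β (x + 1) * majA κ β x := by
    refine intervalIntegral.integral_mono_on (by linarith) (hiA.const_mul _)
      (hcontF.mono (by rw [uIcc_of_le (by linarith)])).intervalIntegrable fun x hx => ?_
    exact mul_le_mul_of_nonneg_right (adjG_le_adjG hκ hβ hg (by linarith) (by linarith [hx.1]))
      (majA_pos hκ hβ h0 hg (by linarith [hx.1])).le
  rw [intervalIntegral.integral_const_mul] at hmonoF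
  have h1 : adjG κ β s * (κ * ∫ x in (s - 1)..s, majA κ β x) ≤ adjG κ β s * (s * majA κ β s) := by
    have : s * adjG κ β s * majA κ β s = κ * ∫ x in (s - 1)..s, adjG κ β (x + 1) * majA κ β x := by
      linarith
    nlinarith [mul_le_mul_of_nonneg_left hmonoF hκ.le]
  exact le_of_mul_le_mul_left h1 hGs

omit hκ h0 hg in
/-- `a` is interval integrable on `[s − 1, s]` for `s > 1`. [folklore] -/
theorem intervalIntegrable_majA {s : ℝ} (hs : 1 < s) :
    IntervalIntegrable (majA κ β) volume (s - 1) s :=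
  (((continuousOn_majA hβ).mono fun x hx => show (0:ℝ) < x by
    rw [uIcc_of_le (by linarith)] at hx; linarith [hx.1])).intervalIntegrable

omit hκ hβ h0 hg in
/-- `log s − log(s − 1) ≤ e^{−log(s−1)}` and the other elementary relations between `y = log(s−1)`
and `ℓ = log s` used by the barriers (`s − 1 ≥ 1`). [folklore] -/
theorem log_aux {s : ℝ} (hs : 2 ≤ s) :
    Real.log (s - 1) ≤ Real.log s ∧ Real.log s ≤ Real.log (s - 1) + Real.exp (-Real.log (s - 1)) ∧
      Real.exp (Real.log (s - 1)) = s - 1 ∧ Real.log s - Real.log (s - 1) ≤ 1 := by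
  have hs1 : 0 < s - 1 := by linarith
  have h1 := log_sub_log_sub_one_le (show 1 < s by linarith)
  have h2 : Real.exp (-Real.log (s - 1)) = 1 / (s - 1) := by
    rw [Real.exp_neg, Real.exp_log hs1, one_div]
  refine ⟨Real.log_le_log hs1 (by linarith), by rw [h2]; linarith, Real.exp_log hs1, ?_⟩
  have : 1 / (s - 1) ≤ 1 := by rw [div_le_one hs1]; linarith
  linarith

/-- **The upper barrier**: `a(s) < M exp(−s log s − s log log s + s log(eκ))` for `s ≥ T`.
[cite: IwaniecActaArith1980, Lemma 13 (6.5)] -/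
theorem exists_majA_lt_exp :
    ∃ M T : ℝ, 0 < M ∧ 2 < T ∧ ∀ s : ℝ, T ≤ s →
      majA κ β s < M * Real.exp (-(s * Real.log s + s * Real.log (Real.log s) -
        s * Real.log (Real.exp 1 * κ))) := by
  obtain ⟨s₁, hs₁β, hG⟩ := exists_adjG_add_one_le hκ hβ hg
  set A : ℝ := 32 * κ with hAdef
  have hA0 : 0 ≤ A := by positivity
  set Y : ℝ := max 1 (max (12 * A) (κ * Real.exp 6)) with hYdef
  have hY1 : 1 ≤ Y := le_max_left _ _
  have hYA : 12 * A ≤ Y := (le_max_left _ _).trans (le_max_right _ _)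
  have hYκ : κ * Real.exp 6 ≤ Y := (le_max_right _ _).trans (le_max_right _ _)
  set T : ℝ := max s₁ (max (β + 3) (Real.exp Y + 2)) with hTdef
  have hTs₁ : s₁ ≤ T := le_max_left _ _
  have hTβ : β + 3 ≤ T := (le_max_left _ _).trans (le_max_right _ _)
  have hTY : Real.exp Y + 2 ≤ T := (le_max_right _ _).trans (le_max_right _ _)
  have heY : Real.exp 1 ≤ Real.exp Y := Real.exp_le_exp.mpr hY1
  have he1 : 1 ≤ Real.exp 1 := by have := Real.add_one_le_exp (1:ℝ); linarith
  have hT2 : 2 < T := by linarith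
  -- the barrier exponent
  set φf : ℝ → ℝ := fun x => x * Real.log x + x * Real.log (Real.log x) -
    x * Real.log (Real.exp 1 * κ) with hφf
  have hφc : ContinuousOn φf (Ioi 1) := continuousOn_phi hκ
  -- `M` from the compact interval `[T - 1, T]`
  have hcontP : ContinuousOn (fun x => majA κ β x * Real.exp (φf x)) (Icc (T - 1) T) :=
    ((continuousOn_majA hβ).mono fun x hx => show (0:ℝ) < x by linarith [hx.1]).mul
      ((hφc.mono fun x hx => show (1:ℝ) < x by linarith [hx.1]).rexp)
  obtain ⟨C, hC⟩ := isCompact_Icc.exists_bound_of_continuousOn hcontP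
  set M : ℝ := max C 0 + 1 with hMdef
  have hM0 : 0 < M := by rw [hMdef]; linarith [le_max_right C 0]
  have hMC : C < M := by rw [hMdef]; linarith [le_max_left C 0]
  refine ⟨M, T, hM0, hT2, fun s hs => ?_⟩
  have key := forall_lt_of_step (f := majA κ β) (g := fun x => M * Real.exp (-φf x)) (T := T)
    ((continuousOn_majA hβ).mono fun x (hx : T ≤ x) => show (0:ℝ) < x by linarith)
    (continuousOn_const.mul ((hφc.mono fun x (hx : T ≤ x) => show (1:ℝ) < x by linarith).neg.rexp))
    ?_ ?_
  · exact key s (by linarith)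
  · -- base: on `[T - 1, T)`
    intro x hx1 hx2
    have hb := hC x ⟨hx1, hx2.le⟩
    rw [Real.norm_eq_abs] at hb
    have h1 : majA κ β x * Real.exp (φf x) < M := lt_of_le_of_lt (le_abs_self _ |>.trans hb) hMC
    have h2 : majA κ β x = majA κ β x * Real.exp (φf x) * Real.exp (-φf x) := by
      rw [mul_assoc, ← Real.exp_add, add_neg_cancel, Real.exp_zero, mul_one]
    rw [h2]
    exact mul_lt_mul_of_pos_right h1 (Real.exp_pos _)
  · -- step
    intro s hsT hIH
    have hs0 : 0 < s := by linarith
    have hs2 : 2 ≤ s := by linarith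
    obtain ⟨hyℓ, hℓy, hey, hℓy1⟩ := log_aux hs2
    have hsY : Real.exp Y ≤ s - 1 := by linarith
    have hy : Y ≤ Real.log (s - 1) := by
      have h := Real.log_le_log (Real.exp_pos Y) hsY; rwa [Real.log_exp] at h
    have hse : Real.exp 1 + 1 ≤ s := by linarith
    have hkeyU := upper_key hκ (A := A) (y := Real.log (s - 1)) (ℓ := Real.log s) (s := s) hA0
      (hY1.trans hy) (hYA.trans hy) (hYκ.trans hy) hyℓ (by linarith) (by rw [hey]; linarith)
    have hK0 : 0 < κ * (1 + A / s) := by positivity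
    have hlo0 : 0 < Real.log (s - 1) + Real.log (Real.log (s - 1)) - Real.log κ := by
      have : 0 < (1 + A / s) * Real.log s * Real.exp (1 / Real.log (s - 1)) := by
        have : 0 < Real.log s := Real.log_pos (by linarith)
        positivity
      linarith
    refine upper_barrier_step hs0 hK0 hM0 (mul_majA_le_integral hκ hβ h0 hg hG (hTs₁.trans hsT)
      (by linarith)) (intervalIntegrable_majA hβ (by linarith))
      (hφc.mono fun x hx => show (1:ℝ) < x by linarith [hx.1])
      (fun x hx => hasDerivAt_phi hκ (by linarith [hx.1]))
      (fun x hx => (phi_deriv_bounds (κ := κ) hse hx).1) (fun x hx => (phi_deriv_bounds (κ := κ) hse hx).2)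
      hlo0 ?_ (fun x hx => (hIH x hx.1.le hx.2).le)
    -- the key inequality: `κ (1 + A/s) e^{hi} = (1 + A/s) s log s e^{1/log(s-1)} ≤ s lo`
    have hexp : Real.exp (Real.log s + Real.log (Real.log s) + 1 / Real.log (s - 1) - Real.log κ) =
        s * Real.log s * Real.exp (1 / Real.log (s - 1)) / κ := by
      rw [Real.exp_sub, Real.exp_add, Real.exp_add, Real.exp_log hs0,
        Real.exp_log (Real.log_pos (by linarith)), Real.exp_log hκ]
    rw [hexp]
    have e : κ * (1 + A / s) * (s * Real.log s * Real.exp (1 / Real.log (s - 1)) / κ) =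
        s * ((1 + A / s) * Real.log s * Real.exp (1 / Real.log (s - 1))) := by
      field_simp
    rw [e]
    exact mul_le_mul_of_nonneg_left hkeyU hs0.le

/-- **The lower barrier**: `a(s) > m exp(−s log s − s log log s + s log(eκ) − 2 s log log s/log s)`
for `s ≥ T`. [cite: IwaniecActaArith1980, Lemma 13 (6.5)] -/
theorem exists_exp_lt_majA :
    ∃ m T : ℝ, 0 < m ∧ 2 < T ∧ ∀ s : ℝ, T ≤ s →
      m * Real.exp (-(s * Real.log s + s * Real.log (Real.log s) - s * Real.log (Real.exp 1 * κ) +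
        2 * (s * Real.log (Real.log s) / Real.log s))) < majA κ β s := by
  set K : ℝ := 9 + |Real.log κ| + 6 * κ with hKdef
  set Y : ℝ := max 1024 (max (Real.exp |Real.log κ|) (max (4 * K + 1) (2 * κ + 1))) with hYdef
  have hY1 : 1024 ≤ Y := le_max_left _ _
  have hYl : Real.exp |Real.log κ| ≤ Y := (le_max_left _ _).trans (le_max_right _ _)
  have hYK : 4 * K + 1 ≤ Y := ((le_max_left _ _).trans (le_max_right _ _)).trans (le_max_right _ _)
  have hYκ : 2 * κ + 1 ≤ Y := ((le_max_right _ _).trans (le_max_right _ _)).trans (le_max_right _ _)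
  set T : ℝ := max (β + 3) (Real.exp Y + 2) with hTdef
  have hTβ : β + 3 ≤ T := le_max_left _ _
  have hTY : Real.exp Y + 2 ≤ T := le_max_right _ _
  have he3 : Real.exp 1 ≤ 3 := by
    have := Real.exp_one_lt_d9; linarith
  have heeY : Real.exp (Real.exp 1) ≤ Real.exp Y := Real.exp_le_exp.mpr (by linarith)
  have hT2 : 2 < T := by linarith
  -- the barrier exponent
  set ψf : ℝ → ℝ := fun x => x * Real.log x + x * Real.log (Real.log x) -
    x * Real.log (Real.exp 1 * κ) + 2 * (x * Real.log (Real.log x) / Real.log x) with hψf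
  have hψc : ContinuousOn ψf (Ioi 1) := continuousOn_psi hκ
  -- `m` from the compact interval `[T - 1, T]`
  have hcontP : ContinuousOn (fun x => majA κ β x * Real.exp (ψf x)) (Icc (T - 1) T) :=
    ((continuousOn_majA hβ).mono fun x hx => show (0:ℝ) < x by linarith [hx.1]).mul
      ((hψc.mono fun x hx => show (1:ℝ) < x by linarith [hx.1]).rexp)
  obtain ⟨x₀, hx₀, hmin⟩ := isCompact_Icc.exists_isMinOn (nonempty_Icc.mpr (by linarith)) hcontP
  set μ : ℝ := majA κ β x₀ * Real.exp (ψf x₀) with hμdef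
  have hμ0 : 0 < μ := mul_pos (majA_pos hκ hβ h0 hg (by linarith [hx₀.1])) (Real.exp_pos _)
  refine ⟨μ / 2, T, by positivity, hT2, fun s hs => ?_⟩
  have key := forall_lt_of_step (f := fun x => μ / 2 * Real.exp (-ψf x)) (g := majA κ β) (T := T)
    (continuousOn_const.mul ((hψc.mono fun x (hx : T ≤ x) => show (1:ℝ) < x by linarith).neg.rexp))
    ((continuousOn_majA hβ).mono fun x (hx : T ≤ x) => show (0:ℝ) < x by linarith)
    ?_ ?_
  · exact key s (by linarith)
  · -- base: on `[T - 1, T)`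
    intro x hx1 hx2
    have hb : μ ≤ majA κ β x * Real.exp (ψf x) := hmin ⟨hx1, hx2.le⟩
    have h1 : μ / 2 < majA κ β x * Real.exp (ψf x) := by linarith
    have h2 : majA κ β x = majA κ β x * Real.exp (ψf x) * Real.exp (-ψf x) := by
      rw [mul_assoc, ← Real.exp_add, add_neg_cancel, Real.exp_zero, mul_one]
    rw [h2]
    exact mul_lt_mul_of_pos_right h1 (Real.exp_pos _)
  · -- step
    intro s hsT hIH
    have hs0 : 0 < s := by linarith
    have hs2 : 2 ≤ s := by linarith
    obtain ⟨hyℓ, hℓy, hey, -⟩ := log_aux hs2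
    have hsY : Real.exp Y ≤ s - 1 := by linarith
    have hy : Y ≤ Real.log (s - 1) := by
      have h := Real.log_le_log (Real.exp_pos Y) hsY; rwa [Real.log_exp] at h
    have hse : Real.exp (Real.exp 1) + 1 ≤ s := by linarith
    have hylog : |Real.log κ| ≤ Real.log (Real.log (s - 1)) := by
      have h := Real.log_le_log (Real.exp_pos _) (hYl.trans hy); rwa [Real.log_exp] at h
    set lo : ℝ := Real.log (s - 1) + Real.log (Real.log (s - 1)) + 1 / Real.log s - Real.log κ +
      2 * (Real.log (Real.log (s - 1)) / Real.log s +
        (1 - Real.log (Real.log s)) / Real.log (s - 1) ^ 2) with hlodef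
    set hi : ℝ := Real.log s + Real.log (Real.log s) + 1 / Real.log (s - 1) - Real.log κ +
      2 * (Real.log (Real.log s) / Real.log (s - 1)) with hhidef
    have hkeyL := lower_key hκ (y := Real.log (s - 1)) (ℓ := Real.log s) (lo := lo) (hi := hi)
      (hY1.trans hy) hylog (hYK.trans hy) (hYκ.trans hy) hyℓ hℓy (by rw [hlodef]; ring) hhidef
    rw [hey, show s - 1 + 1 = s by ring] at hkeyL
    have hhi0 : 0 < hi := by
      have hy0 : 0 < Real.log (s - 1) := by linarith
      have h1 : Real.log (Real.log (s - 1)) ≤ Real.log (s - 1) - 1 := Real.log_le_sub_one_of_pos hy0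
      have h2 : Real.log κ ≤ |Real.log κ| := le_abs_self _
      have h3 : 0 ≤ Real.log (Real.log s) := by
        have : Real.log (Real.log (s - 1)) ≤ Real.log (Real.log s) := Real.log_le_log hy0 hyℓ
        linarith [abs_nonneg (Real.log κ)]
      have h4 : 0 ≤ 1 / Real.log (s - 1) := by positivity
      have h5 : 0 ≤ 2 * (Real.log (Real.log s) / Real.log (s - 1)) := by positivity
      rw [hhidef]; linarith
    exact lower_barrier_step hs0 hκ (by positivity) (integral_majA_le hκ hβ h0 hg (by linarith))
      (intervalIntegrable_majA hβ (by linarith))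
      (hψc.mono fun x hx => show (1:ℝ) < x by linarith [hx.1])
      (fun x hx => hasDerivAt_psi hκ (by linarith [hx.1]))
      (fun x hx => (psi_deriv_bounds (κ := κ) hse hx).1) (fun x hx => (psi_deriv_bounds (κ := κ) hse hx).2)
      hhi0 hkeyL (fun x hx => (hIH x hx.1.le hx.2).le)

end Main

end RosserMajorant

end Literature.NumberTheory.Sieve
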